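import Summits.ValiantsHypothesis.ValiantsHypothesis.Theorems.BarrierLeverAnchoredDoorHitsLowerPairsGenSplit
import Summits.ValiantsHypothesis.ValiantsHypothesis.Theorems.BarrierLeverAnchoredDoorHitsLowerPairsBase
import Summits.ValiantsHypothesis.ValiantsHypothesis.Theorems.BarrierLeverAnchoredDoorHitsLowerPairsSwap

/-!
# Support item `AnchoredDoorHitsLowerPairs` (stmt-ValiantsHypothesis-22510), line `anchored-peeling`:
# SPLIT ROUTINGS (schedule + split) as a typed stub, and the induction SR ⟹ symbolic non-vanishing

Helper file (`--supports stmt-ValiantsHypothesis-22510`; cell valiant-natproofs, rung V4, 𝒟-side door (c); registered line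
`Cruxes/AnchoredDoorHitsLowerPairs/Lines/anchored_peeling.lean` v10; prover seat val-np-p1 gen 18). Two `def … : Prop` (`DTPeel.SRData`, the finite data of a
split routing on the `x`-side; `Stmt.stub_sr`, the stub text OFFERED to the planner under D-0145 — NOT asserted) and the landed transfer. Closes NO item.

* `DTPeel.SRData u w` — a valid `x`-side schedule of DT-peel stages (p595531) whose final generalized rows are pairwise distinct, an injective list of
  shifts `S_0..S_{m-1}` with every final shift listed (`runE i = S_{rk i}`), the SIZE CONDITION of the split lemma (p604244: as many rows of shift `S_j` as
  columns whose first contained shift is `S_j`), and NON-TRIVIALITY (every shift class has fewer than `r` rows). Routings (all classes singletons with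
  `runU = ∅`) and decomposing DT-stages (one stage) are special cases.
* `DTPeel.shiftBlocks_lower_of_schedule` — along a valid `x`-side schedule started from a LOWER row family, for every shift value the `x`-sets of the
  rows carrying that shift form a lower family (so the sub-pairs of a split are again simplicial-complex pairs).
* `Stmt.stub_sr` — **CONJECTURE SR**: every injective simplicial-complex pair with `r ≥ 2` rows admits split-routing data on the `x`-side or the `y`-side.
* `DTPeel.symbolicDet_ne_zero_of_sr` — SR ⟹ `symbolicDet s h r u w ≠ 0` for every injective lower pair and every `s ≥ 1` (strong induction on `r`;
  `y`-side by `symbolicDet_ne_zero_swap`); `stub_symbolicNonvanishing_of_sr` (`s := 1`, `h₀ := 0`).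
EVIDENCE / STATUS: SR contains every certificate format of the line that is a DT-peel computation (star steps, thin steps' SDR, routings, DTS); single-stage
data exist for all 153 864 pairs ≤ 5×5 and all censused larger pairs (memo HOME/val-np-p1/g18/DTS-MEMO-valnp1-g18.md §3); for the complete-graph-vs-cube
pairs single-stage data provably do not exist on the `x`-side and multi-stage existence is OPEN (memo §5, §7). CHEAPEST FALSIFIER: a lower pair with no
split routing on either side (needs a multi-stage search engine; lab/kitcarve is the single-stage `y`-side engine).

WHAT THIS IS NOT: no claim that SR holds; nothing on crux stmt-ValiantsHypothesis-14610 or on `VP` versus `VNP`.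
-/

set_option linter.dupNamespace false

namespace Summit.ValiantsHypothesis.ValiantsHypothesis.Theorems.BarrierLever.AnchoredPeeling

open Finset MvPolynomial

noncomputable section

namespace DTPeel

variable {h : ℕ}

/-- Split-routing data on the `x`-side of the layout `(u, w)`. -/
def SRData {r : ℕ} (u w : Fin r → Finset (Fin h)) : Prop :=
  ∃ (L : List (Stage h r)) (m : ℕ) (S : Fin m → Finset (Fin h)) (rk : Fin r → Fin m),
    ValidSched L u (fun _ => ∅) ∧ Function.Injective S ∧
    (∀ i i', runU L u i = runU L u i' → runE L u (fun _ => ∅) i = runE L u (fun _ => ∅) i' → i = i') ∧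
    (∀ i, runE L u (fun _ => ∅) i = S (rk i)) ∧
    (∀ j : Fin m, (univ.filter fun i => rk i = j).card =
      (univ.filter fun k => S j ⊆ w k ∧ ∀ j', j' < j → ¬ S j' ⊆ w k).card) ∧
    (∀ j : Fin m, (univ.filter fun i => rk i = j).card < r)

/-! ## Shift classes stay lower along a valid schedule -/

section Lower

variable {r : ℕ}

/-- «For every shift value, the `x`-sets of the rows with that shift form a lower family.» -/
def ShiftBlocksLower (U E : Fin r → Finset (Fin h)) : Prop :=
  ∀ E₀ : Finset (Fin h), IsLowerSet {V : Finset (Fin h) | ∃ i, E i = E₀ ∧ U i = V}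

/-- One valid stage preserves `ShiftBlocksLower`. -/
theorem shiftBlocksLower_stage (σ : Stage h r) (U E : Fin r → Finset (Fin h)) (hv : σ.Valid U E) (hl : ShiftBlocksLower U E) :
    ShiftBlocksLower (σ.newU U) (σ.newE U E) := by
  obtain ⟨_, haB, _, hcls, hmin, _⟩ := hv
  intro E₀' V V' hV'V hV
  obtain ⟨i, hiE, hiU⟩ := hV
  by_cases hai : σ.a ∈ U i
  · -- a link row of class `cls i`: V = (U i ∖ a) ∖ B_cls
    rw [Stage.newU, if_pos hai] at hiU
    rw [Stage.newE, if_pos hai] at hiE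
    have hBi : σ.B (σ.cls i) ⊆ (U i).erase σ.a := hcls i hai
    have hVsub : V ⊆ (U i).erase σ.a := hiU ▸ Finset.sdiff_subset
    have hVdisj : Disjoint V (σ.B (σ.cls i)) := hiU ▸ Finset.sdiff_disjoint
    -- the candidate row insert a (V' ∪ B) lies below U i in the block of shift E i
    set U' : Finset (Fin h) := insert σ.a (V' ∪ σ.B (σ.cls i)) with hU'
    have hU'sub : U' ⊆ U i := by
      intro x hx
      rw [hU', Finset.mem_insert, Finset.mem_union] at hx
      rcases hx with rfl | hx | hx
      · exact hai
      · exact Finset.mem_of_mem_erase (hVsub (hV'V hx))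
      · exact Finset.mem_of_mem_erase (hBi hx)
    obtain ⟨i', hi'E, hi'U⟩ := hl (E i) hU'sub ⟨i, rfl, rfl⟩
    have hai' : σ.a ∈ U i' := by rw [hi'U, hU']; exact Finset.mem_insert_self _ _
    have haV' : σ.a ∉ V' := fun h' => Finset.notMem_erase σ.a (U i) (hVsub (hV'V h'))
    have hera : (U i').erase σ.a = V' ∪ σ.B (σ.cls i) := by
      rw [hi'U, hU', Finset.erase_insert]
      rw [Finset.mem_union, not_or]
      exact ⟨haV', haB _⟩
    have hcls' : σ.cls i' = σ.cls i := by
      rcases lt_trichotomy (σ.cls i') (σ.cls i) with hlt | heq | hgt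
      · exfalso
        apply hmin i hai (σ.cls i') hlt
        have h1 : σ.B (σ.cls i') ⊆ (U i').erase σ.a := hcls i' hai'
        rw [hera] at h1
        intro x hx
        have hx' := h1 hx
        rw [Finset.mem_union] at hx'
        rcases hx' with hx' | hx'
        · exact hVsub (hV'V hx')
        · exact hBi hx'
      · exact heq
      · exfalso
        exact hmin i' hai' (σ.cls i) hgt (hera ▸ Finset.subset_union_right)
    refine ⟨i', ?_, ?_⟩
    · rw [Stage.newE, if_pos hai', hi'E, hcls', hiE]
    · rw [Stage.newU, if_pos hai', hera, hcls', Finset.union_sdiff_cancel_right (Disjoint.mono_left hV'V hVdisj)]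
  · -- a deletion row: unchanged
    rw [Stage.newU, if_neg hai] at hiU
    rw [Stage.newE, if_neg hai] at hiE
    obtain ⟨i', hi'E, hi'U⟩ := hl E₀' (hiU ▸ hV'V) ⟨i, hiE, rfl⟩
    have hai' : σ.a ∉ U i' := by rw [hi'U]; exact fun h' => hai (hiU ▸ hV'V h')
    refine ⟨i', ?_, ?_⟩
    · rw [Stage.newE, if_neg hai', hi'E]
    · rw [Stage.newU, if_neg hai', hi'U]

/-- **Shift classes stay lower** along a valid `x`-side schedule started with empty shifts from a lower row family. -/
theorem shiftBlocks_lower_of_schedule :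
    ∀ (L : List (Stage h r)) (U E : Fin r → Finset (Fin h)), ValidSched L U E → ShiftBlocksLower U E →
      ShiftBlocksLower (runU L U) (runE L U E)
  | [], _, _, _, hl => hl
  | σ :: rest, U, E, hv, hl => shiftBlocks_lower_of_schedule rest _ _ hv.2 (shiftBlocksLower_stage σ U E hv.1 hl)

/-- Initially (all shifts empty) the single shift class is the row family. -/
theorem shiftBlocksLower_init (u : Fin r → Finset (Fin h)) (hlu : IsLowerSet (Set.range u)) :
    ShiftBlocksLower u (fun _ => (∅ : Finset (Fin h))) := by
  intro E₀ V V' hV'V hV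
  obtain ⟨i, hiE, hiU⟩ := hV
  obtain ⟨i', hi'⟩ := hlu (hiU ▸ hV'V : V' ⊆ u i) ⟨i, rfl⟩
  exact ⟨i', hiE, hi'⟩

end Lower

/-! ## The induction SR ⟹ U1 -/

section Induction

variable {s r : ℕ}

/-- **One split routing + the induction hypothesis below `r` ⟹ non-vanishing.** -/
theorem symbolicDet_ne_zero_of_srData (hs : 1 ≤ s)
    (ih : ∀ r', r' < r → ∀ (u' w' : Fin r' → Finset (Fin h)), Function.Injective u' → Function.Injective w' →
      IsLowerSet (Set.range u') → IsLowerSet (Set.range w') → symbolicDet s h r' u' w' ≠ 0)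
    (u w : Fin r → Finset (Fin h)) (hw : Function.Injective w)
    (hlu : IsLowerSet (Set.range u)) (hlw : IsLowerSet (Set.range w)) (hdata : SRData u w) :
    symbolicDet s h r u w ≠ 0 := by
  classical
  obtain ⟨L, m, S, rk, hv, hS, hUE, hrk, hcount, hsmall⟩ := hdata
  have hblocks := shiftBlocks_lower_of_schedule L u (fun _ => ∅) hv (shiftBlocksLower_init u hlu)
  refine symbolicDet_ne_zero_of_schedule_split (S := S) (rk := rk) hs u hw L hv hUE hrk hcount ?_
  intro j r₁ u₁ w₁ hu₁ hw₁ hru hrw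
  refine ih r₁ ?_ u₁ w₁ hu₁ hw₁ ?_ ?_
  · -- r₁ = size of the class of shift S j < r
    have hcard : (Finset.univ.image u₁).card ≤ (univ.filter fun i => rk i = j).card := by
      have hsub : Finset.univ.image u₁ ⊆ (univ.filter fun i => rk i = j).image (runU L u) := by
        intro V hV
        obtain ⟨k, -, rfl⟩ := Finset.mem_image.mp hV
        have hk : u₁ k ∈ Set.range u₁ := ⟨k, rfl⟩
        rw [hru] at hk
        obtain ⟨i, hi, hiV⟩ := hk
        exact Finset.mem_image.mpr ⟨i, Finset.mem_filter.mpr ⟨Finset.mem_univ _, hi⟩, hiV⟩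
      exact (Finset.card_le_card hsub).trans Finset.card_image_le
    rw [Finset.card_image_of_injective _ hu₁, Finset.card_univ, Fintype.card_fin] at hcard
    exact lt_of_le_of_lt hcard (hsmall j)
  · rw [hru]
    intro V V' hV'V hV
    obtain ⟨i, hi, hiV⟩ := hV
    have hiE : runE L u (fun _ => ∅) i = S j := by rw [hrk i, hi]
    obtain ⟨i', hi'E, hi'U⟩ := hblocks (S j) hV'V ⟨i, hiE, hiV⟩
    refine ⟨i', hS ?_, hi'U⟩
    rw [← hrk i', hi'E]
  · rw [hrw]
    intro T T' hT'T hT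
    refine ⟨Disjoint.mono_left hT'T hT.1, hlw (Finset.union_subset_union hT'T subset_rfl) hT.2.1, fun j' hj' hS => hT.2.2 j' hj' ?_⟩
    exact hS.trans (Finset.union_subset_union hT'T subset_rfl)

end Induction

end DTPeel

/-- **STUB (CONJECTURE SR).** Every injective simplicial-complex pair with at least two rows admits split-routing data on the `x`-side or on the
`y`-side. -/
def Stmt.stub_sr : Prop :=
  ∀ (h r : ℕ) (u w : Fin r → Finset (Fin h)), Function.Injective u → Function.Injective w →
    IsLowerSet (Set.range u) → IsLowerSet (Set.range w) → 2 ≤ r →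
    DTPeel.SRData u w ∨ DTPeel.SRData w u

namespace DTPeel

/-- **SR ⟹ symbolic non-vanishing on every injective simplicial-complex pair, at every profile `s ≥ 1`** (strong induction on `r`; base `stub_base`;
the `y`-side case by `symbolicDet_ne_zero_swap`). -/
theorem symbolicDet_ne_zero_of_sr {s : ℕ} (hD : Stmt.stub_sr) (hs : 1 ≤ s) (h r : ℕ) (u w : Fin r → Finset (Fin h))
    (hu : Function.Injective u) (hw : Function.Injective w)
    (hlu : IsLowerSet (Set.range u)) (hlw : IsLowerSet (Set.range w)) : symbolicDet s h r u w ≠ 0 := by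
  revert u w
  induction r using Nat.strong_induction_on with
  | _ r ih =>
    intro u w hu hw hlu hlw
    by_cases hr : r ≤ 1
    · exact stub_base s h r u w hu hw hlu hlw hr
    · rcases hD h r u w hu hw hlu hlw (by omega) with hx | hy
      · exact symbolicDet_ne_zero_of_srData hs ih u w hw hlu hlw hx
      · exact symbolicDet_ne_zero_swap s h r u w
          (symbolicDet_ne_zero_of_srData hs (fun r' hr' u' w' hu' hw' hlu' hlw' => ih r' hr' u' w' hu' hw' hlu' hlw')
            w u hu hlw hlu hy)

end DTPeel

/-- **CONJECTURE SR implies the line's symbolic non-vanishing stub** (`s := 1`, `h₀ := 0`). -/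
theorem stub_symbolicNonvanishing_of_sr (H : Stmt.stub_sr) : Stmt.stub_symbolicNonvanishing :=
  ⟨1, 0, fun h _ r u w hu hw hlu hlw => DTPeel.symbolicDet_ne_zero_of_sr H le_rfl h r u w hu hw hlu hlw⟩

/-- Profile-1 form, in the shape the skeleton's compositions use. -/
theorem symbolicDet_one_ne_zero_of_sr (H : Stmt.stub_sr) (h r : ℕ) (u w : Fin r → Finset (Fin h))
    (hu : Function.Injective u) (hw : Function.Injective w)
    (hlu : IsLowerSet (Set.range u)) (hlw : IsLowerSet (Set.range w)) : symbolicDet 1 h r u w ≠ 0 :=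
  DTPeel.symbolicDet_ne_zero_of_sr H le_rfl h r u w hu hw hlu hlw

end

end Summit.ValiantsHypothesis.ValiantsHypothesis.Theorems.BarrierLever.AnchoredPeeling
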